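import Summits.AnomalousDissipation.AnomalousDissipation.Theorems.SolenoidalFractalHomogenisationLagrangianStepVmodFastSlowAssembly
import HarnessLib

/-!
# K1L_D (stmt-AnomalousDissipation-27980), (V_mod) flat stage (ℓ2): ASSEMBLY of the SLOW-datum × FAST-test block (sf) from PER-LABEL SIDEBAND
# bounds on pair data (abstract `V2` statement; prover ad-k3l-bookkeeping-p1 g10, (sf) owner by RULING D28-5; `--supports 27980 --as helper`)

The (sf) companion of `…FlatBilinearAssembly` (slow × slow, lead-k1l-onelevel-p1 g4) and `…VmodFastSlowAssembly` (fast × slow, ad-k1loc-p3 g10).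
Setting: window maps `U, T : V2 →L[ℝ] V2`; `U` sees only the divergence-free projection of its argument and PRESERVES CLASS PAIRS of the grid
`(n⁻¹ℤ)³` (`hUcl`: a datum vanishing on the class pair `{≡ c} ∪ {≡ −c} (mod n)` is mapped to one; `…PropagatorClass.fcoeff_apply_eq_zero_of_classes`);
`T` is a Fourier multiplier (`hTmode`: a vanishing coefficient stays vanishing, `VmodFlat.coarseSupp`); `S` = the nonzero slow frequencies, symmetric,
alone in their class pairs and not self-conjugate (`2·(n/4) < n`); `Z ⊇ S` = the frequencies on which the tests vanish (in the lane: `Z = freqBall (n/4)`,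
i.e. `IsFast` tests).  SIDEBAND HYPOTHESIS (what the high-label decay W7 / the grid iteration T-I of the cell flow deliver): for every `ℓ ∈ S`, every
weakly divergence-free `w` carried by `{ℓ, −ℓ}` and every test `y` vanishing on `Z`, `|⟪U w, y⟫| ≤ ε_ℓ·‖w‖·‖y‖`.  Then for every `S`-supported datum `x`
and every `Z`-vanishing test `y`:

* `classPair_of_classPair_of_classPair` — the relation «`k ≡ ±c (mod n)`» is transitive (so `U w` is CARRIED by the class pair of `ℓ`);
* `two_smul_eq_sum_pairParts` — an `S`-supported datum is half the sum of its class-pair parts, `2•x′ = Σ_{ℓ∈S} 2•R_ℓ x′`;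
* **`abs_inner_sub_le_of_slow_sideband`** — `|⟪U x − T x, y⟫| ≤ √(Σ_{ℓ∈S} ε_ℓ² ‖𝓕x(ℓ)‖²) · ‖y‖` (`T x` stays slow hence `⊥ y`; class preservation
  isolates the pairing of `U(2•R_ℓ x′)` with the class-pair part `2•R_ℓ y` of the test; the sideband hypothesis; Cauchy–Schwarz over `S`; the count
  `sum_norm_sq_classPairPart_le`; conjugate symmetry `‖2•R_ℓ x′‖² = 2‖𝓕x′(ℓ)‖²`);
* `abs_inner_sub_le_sqrt_of_slow_sideband` — with `ε_ℓ ≤ η·√(d_ℓ)`: `≤ η·√(Σ_S d_ℓ‖𝓕x(ℓ)‖²)·‖y‖`, the shape the loss currency consumes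
  (`Σ_S d_ℓ‖x̂(ℓ)‖² ≤ q_T(x)` by `VmodFlat.sum_weight_le_lossFwd`, `‖y‖² ≤ q*_T(y)/(1 − e^{−y_f})` by `lossAdj_ge_of_supp`).
Certifier table `Cruxes/LagrangianRenormalisationStep/Lines/onelevel-ss-regimes.md` §1 (R-b)/(R-c), §4 (sf).  NOT a proof of any block, of
`stub_Vmod_EHT`, of K1L_D or of AD; rung F-D1.A0.
-/

set_option linter.dupNamespace false

noncomputable section

namespace Summit.AnomalousDissipation.AnomalousDissipation.Theorems.SolenoidalFractalHomogenisation.LagrangianStep.VmodFlat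

open Literature.Analysis Literature.Analysis.FluidPDE Literature.Analysis.FluidPDE.Torus Literature.Analysis.FunctionSpaces
open MeasureTheory Set Filter UnitAddTorus
open scoped ENNReal NNReal InnerProductSpace
open OneLevelSplit
open Summit.AnomalousDissipation.AnomalousDissipation.Theorems.SolenoidalFractalHomogenisation.LagrangianStep.PropagatorSymm
  (fcoeff_two_smul_pairAvg pairAvg_mem_divFreeL2)

variable {n : ℕ}

/-! ## §1 Arithmetic of class pairs and coefficient bookkeeping -/

/-- **Transitivity of «`≡ ±· (mod n)`»**: if `k′ ≡ ±k` and `k′ ≡ ±c` then `k ≡ ±c`. [folklore] -/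
theorem classPair_of_classPair_of_classPair {k k' c : Fin 3 → ℤ}
    (hk : (∀ i, (n:ℤ) ∣ k' i - k i) ∨ (∀ i, (n:ℤ) ∣ k' i + k i))
    (hc : (∀ i, (n:ℤ) ∣ k' i - c i) ∨ (∀ i, (n:ℤ) ∣ k' i + c i)) :
    (∀ i, (n:ℤ) ∣ k i - c i) ∨ (∀ i, (n:ℤ) ∣ k i + c i) := by
  rcases hk with hk | hk <;> rcases hc with hc | hc
  · left; intro i
    have h := dvd_sub (hc i) (hk i)
    rwa [show k' i - c i - (k' i - k i) = k i - c i by ring] at h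
  · right; intro i
    have h := dvd_sub (hc i) (hk i)
    rwa [show k' i + c i - (k' i - k i) = k i + c i by ring] at h
  · right; intro i
    have h := dvd_sub (hk i) (hc i)
    rwa [show k' i + k i - (k' i - c i) = k i + c i by ring] at h
  · left; intro i
    have h := dvd_sub (hk i) (hc i)
    rwa [show k' i + k i - (k' i + c i) = k i - c i by ring] at h

/-- `𝓕(Σ_{i∈s} f i)(k) = Σ_{i∈s} 𝓕(f i)(k)` on `V2`. -/
theorem fcoeff_finset_sum {ι : Type*} (s : Finset ι) (f : ι → V2) (k : Fin 3 → ℤ) :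
    mFourierCoeff (EuclideanSpace.complexify ∘ ⇑(∑ i ∈ s, f i)) k = ∑ i ∈ s, mFourierCoeff (EuclideanSpace.complexify ∘ ⇑(f i)) k := by
  classical
  induction s using Finset.induction_on with
  | empty =>
      rw [Finset.sum_empty, Finset.sum_empty]
      have h := fcoeff_smul (0:ℝ) (0 : V2) k
      rwa [zero_smul, Complex.ofReal_zero, zero_smul] at h
  | insert a s ha ih => rw [Finset.sum_insert ha, Finset.sum_insert ha, fcoeff_add, ih]

/-- For a real `V2` class and a label `ℓ ≠ −ℓ`, a datum carried by `{ℓ, −ℓ}` has `‖w‖² = 2‖𝓕w(ℓ)‖²` (Parseval + conjugate symmetry). -/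
theorem norm_sq_eq_two_mul_of_pair {ℓ : Fin 3 → ℤ} (hne : ℓ ≠ -ℓ) (w : V2)
    (hw : ∀ k, k ≠ ℓ → k ≠ -ℓ → mFourierCoeff (EuclideanSpace.complexify ∘ ⇑w) k = 0) :
    ‖w‖ ^ 2 = 2 * ‖mFourierCoeff (EuclideanSpace.complexify ∘ ⇑w) ℓ‖ ^ 2 := by
  have hpars := hasSum_norm_sq_fcoeff w
  have hfin : HasSum (fun k => ‖mFourierCoeff (EuclideanSpace.complexify ∘ ⇑w) k‖ ^ 2)
      (∑ k ∈ ({ℓ, -ℓ} : Finset (Fin 3 → ℤ)), ‖mFourierCoeff (EuclideanSpace.complexify ∘ ⇑w) k‖ ^ 2) := by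
    refine hasSum_sum_of_ne_finset_zero fun k hk => ?_
    rw [Finset.mem_insert, Finset.mem_singleton, not_or] at hk
    rw [hw k hk.1 hk.2, norm_zero, zero_pow two_ne_zero]
  have hsymm : mFourierCoeff (EuclideanSpace.complexify ∘ ⇑w) (-ℓ) = EuclideanSpace.conjVec (mFourierCoeff (EuclideanSpace.complexify ∘ ⇑w) ℓ) :=
    Torus.isConjSymm_mFourierCoeff (integrable_coe_V2 w) ℓ
  rw [hpars.unique hfin, Finset.sum_pair hne, hsymm, EuclideanSpace.norm_conjVec]; ring

/-! ## §2 An `S`-supported datum is half the sum of its class-pair parts -/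

/-- **`2•x = Σ_{ℓ∈S} 2•R_ℓ x`** for `x` supported on the symmetric, alone-in-class-pairs, non-self-conjugate set `S`: every frequency `k ∈ S` is charged by
exactly the two labels `k, −k`. [folklore] -/
theorem two_smul_eq_sum_pairParts (S : Finset (Fin 3 → ℤ)) (hn : 0 < n) (hSneg : ∀ k ∈ S, -k ∈ S)
    (halone : ∀ ℓ ∈ S, ∀ k ∈ S, ((∀ i, (n:ℤ) ∣ k i - ℓ i) ∨ (∀ i, (n:ℤ) ∣ k i + ℓ i)) → k = ℓ ∨ k = -ℓ)
    (hnsc : ∀ ℓ ∈ S, ¬ (∀ i, (n:ℤ) ∣ ℓ i + ℓ i)) (x : V2)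
    (hxS : ∀ k, k ∉ S → mFourierCoeff (EuclideanSpace.complexify ∘ ⇑x) k = 0) (v : (Fin 3 → ℤ) → V2)
    (hv : ∀ ℓ ∈ S, ∀ k, mFourierCoeff (EuclideanSpace.complexify ∘ ⇑(v ℓ)) k =
      if ((∀ i, (n:ℤ) ∣ k i - ℓ i) ∨ (∀ i, (n:ℤ) ∣ k i + ℓ i)) then mFourierCoeff (EuclideanSpace.complexify ∘ ⇑x) k else 0) :
    (2:ℝ) • x = ∑ ℓ ∈ S, v ℓ := by
  classical
  have _ := hn
  apply eq_of_fcoeff_eq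
  intro k
  rw [fcoeff_smul, fcoeff_finset_sum, Finset.sum_congr rfl fun ℓ hℓ => hv ℓ hℓ k, ← Finset.sum_filter, Finset.sum_const]
  by_cases hk : k ∈ S
  · -- exactly the two labels `k, −k` charge `k`
    have hne : k ≠ -k := fun h => hnsc k hk fun i => by
      have hi := congrFun h i; simp only [Pi.neg_apply] at hi
      exact ⟨0, by linarith⟩
    have hsub : ({k, -k} : Finset (Fin 3 → ℤ)) ⊆ S.filter fun ℓ => (∀ i, (n:ℤ) ∣ k i - ℓ i) ∨ (∀ i, (n:ℤ) ∣ k i + ℓ i) := by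
      intro ℓ hℓ
      rw [Finset.mem_insert, Finset.mem_singleton] at hℓ
      rw [Finset.mem_filter]
      rcases hℓ with rfl | rfl
      · exact ⟨hk, Or.inl fun i => by simp⟩
      · exact ⟨hSneg k hk, Or.inr fun i => by simp⟩
    have hcard : (S.filter fun ℓ => (∀ i, (n:ℤ) ∣ k i - ℓ i) ∨ (∀ i, (n:ℤ) ∣ k i + ℓ i)).card = 2 := by
      have h2 := card_filter_classPair_le_two S halone hnsc k
      have h1 : 2 ≤ (S.filter fun ℓ => (∀ i, (n:ℤ) ∣ k i - ℓ i) ∨ (∀ i, (n:ℤ) ∣ k i + ℓ i)).card := by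
        rw [← Finset.card_pair hne]; exact Finset.card_le_card hsub
      omega
    rw [hcard, ← Nat.cast_smul_eq_nsmul ℂ (2:ℕ)]
    norm_num
  · rw [hxS k hk, smul_zero, smul_zero]

/-! ## §3 The assembly -/

set_option maxHeartbeats 1600000 in
/-- **ASSEMBLY OF THE (sf) BLOCK FROM PER-LABEL SIDEBAND BOUNDS.**  `U` sees only `P_σ`; `U` preserves class pairs; `T` keeps vanishing coefficients
vanishing; `S` symmetric, alone-in-class-pairs, not self-conjugate, `S ⊆ Z`; SIDEBAND: `|⟪U w, y⟫| ≤ ε_ℓ‖w‖‖y‖` for weakly divergence-free `w` carried by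
`{ℓ, −ℓ}` and tests `y` vanishing on `Z`.  Then for `S`-supported `x` and `Z`-vanishing `y`:
`|⟪U x − T x, y⟫| ≤ √(Σ_{ℓ∈S} ε_ℓ² ‖𝓕x(ℓ)‖²) · ‖y‖`. -/
theorem abs_inner_sub_le_of_slow_sideband (S : Finset (Fin 3 → ℤ)) (Z : Set (Fin 3 → ℤ)) (U T : V2 →L[ℝ] V2) (ε : (Fin 3 → ℤ) → ℝ)
    (hn : 0 < n) (hSneg : ∀ k ∈ S, -k ∈ S)
    (halone : ∀ ℓ ∈ S, ∀ k ∈ S, ((∀ i, (n:ℤ) ∣ k i - ℓ i) ∨ (∀ i, (n:ℤ) ∣ k i + ℓ i)) → k = ℓ ∨ k = -ℓ)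
    (hnsc : ∀ ℓ ∈ S, ¬ (∀ i, (n:ℤ) ∣ ℓ i + ℓ i)) (hSZ : ∀ k ∈ S, k ∈ Z)
    (hUP : ∀ x : V2, U x = U ((divFreeL2 (Fin 3)).starProjection x))
    (hUcl : ∀ (c : Fin 3 → ℤ) (x : V2), (∀ k', ((∀ i, (n:ℤ) ∣ k' i - c i) ∨ (∀ i, (n:ℤ) ∣ k' i + c i)) →
        mFourierCoeff (EuclideanSpace.complexify ∘ ⇑x) k' = 0) →
      ∀ k, ((∀ i, (n:ℤ) ∣ k i - c i) ∨ (∀ i, (n:ℤ) ∣ k i + c i)) → mFourierCoeff (EuclideanSpace.complexify ∘ ⇑(U x)) k = 0)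
    (hTmode : ∀ (x : V2) (k : Fin 3 → ℤ), mFourierCoeff (EuclideanSpace.complexify ∘ ⇑x) k = 0 →
      mFourierCoeff (EuclideanSpace.complexify ∘ ⇑(T x)) k = 0)
    (hsb : ∀ ℓ ∈ S, ∀ w : V2, w ∈ divFreeL2 (Fin 3) →
      (∀ k, k ≠ ℓ → k ≠ -ℓ → mFourierCoeff (EuclideanSpace.complexify ∘ ⇑w) k = 0) →
      ∀ y : V2, (∀ k ∈ Z, mFourierCoeff (EuclideanSpace.complexify ∘ ⇑y) k = 0) → |⟪U w, y⟫_ℝ| ≤ ε ℓ * ‖w‖ * ‖y‖)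
    (x y : V2) (hxS : ∀ k, k ∉ S → mFourierCoeff (EuclideanSpace.complexify ∘ ⇑x) k = 0)
    (hyZ : ∀ k ∈ Z, mFourierCoeff (EuclideanSpace.complexify ∘ ⇑y) k = 0) :
    |⟪U x - T x, y⟫_ℝ| ≤ Real.sqrt (∑ ℓ ∈ S, ε ℓ ^ 2 * ‖mFourierCoeff (EuclideanSpace.complexify ∘ ⇑x) ℓ‖ ^ 2) * ‖y‖ := by
  classical
  -- ### the coarse member keeps `x` slow, hence `⊥ y`
  have hT0 : ⟪T x, y⟫_ℝ = 0 := by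
    have hTx : ∀ k, k ∉ S → mFourierCoeff (EuclideanSpace.complexify ∘ ⇑(T x)) k = 0 := fun k hk => hTmode x k (hxS k hk)
    rw [real_inner_comm, inner_eq_sum_of_support S y (T x) hTx]
    exact Finset.sum_eq_zero fun k hk => by rw [hyZ k (hSZ k hk), inner_zero_left, Complex.zero_re]
  -- ### reduce to the divergence-free projection of `x`
  set x' : V2 := (divFreeL2 (Fin 3)).starProjection x with hx'
  have hx'mem : x' ∈ divFreeL2 (Fin 3) := (divFreeL2 (Fin 3)).starProjection_apply_mem x
  have hdom : ∀ k, ‖mFourierCoeff (EuclideanSpace.complexify ∘ ⇑x') k‖ ≤ ‖mFourierCoeff (EuclideanSpace.complexify ∘ ⇑x) k‖ :=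
    fun k => norm_mFourierCoeff_starProjection_le x k
  have hx'S : ∀ k, k ∉ S → mFourierCoeff (EuclideanSpace.complexify ∘ ⇑x') k = 0 := fun k hk => by
    have h := hdom k; rw [hxS k hk, norm_zero] at h; exact norm_eq_zero.1 (le_antisymm h (norm_nonneg _))
  have e0 : ⟪U x - T x, y⟫_ℝ = ⟪U x', y⟫_ℝ := by rw [inner_sub_left, hT0, sub_zero, ← hUP x]
  -- ### the class-pair parts of `x'` and of `y`
  set v : (Fin 3 → ℤ) → V2 := fun ℓ => (2:ℝ) • ∑ j : Fin 3 → Fin n,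
        (1 / (n:ℝ) ^ 3 * Real.cos (2 * Real.pi * (∑ i, (ℓ i : ℝ) * ((j i : ℕ) : ℝ)) / n)) •
          Lp.compMeasurePreserving (fun z : UnitAddTorus (Fin 3) => z + (fun i => ((((j i : ℕ) : ℝ) / n : ℝ) : UnitAddCircle)))
            (measurePreserving_add_right volume _) x' with hvdef
  have hvc : ∀ ℓ ∈ S, ∀ k, mFourierCoeff (EuclideanSpace.complexify ∘ ⇑(v ℓ)) k
      = if ((∀ i, (n:ℤ) ∣ k i - ℓ i) ∨ (∀ i, (n:ℤ) ∣ k i + ℓ i)) then mFourierCoeff (EuclideanSpace.complexify ∘ ⇑x') k else 0 :=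
    fun ℓ hℓ k => fcoeff_two_smul_pairAvg hn ℓ (hnsc ℓ hℓ) x' k
  have hvdiv : ∀ ℓ, v ℓ ∈ divFreeL2 (Fin 3) := fun ℓ => pairAvg_mem_divFreeL2 ℓ 2 hx'mem
  set u : (Fin 3 → ℤ) → V2 := fun ℓ => (2:ℝ) • ∑ j : Fin 3 → Fin n,
        (1 / (n:ℝ) ^ 3 * Real.cos (2 * Real.pi * (∑ i, (ℓ i : ℝ) * ((j i : ℕ) : ℝ)) / n)) •
          Lp.compMeasurePreserving (fun z : UnitAddTorus (Fin 3) => z + (fun i => ((((j i : ℕ) : ℝ) / n : ℝ) : UnitAddCircle)))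
            (measurePreserving_add_right volume _) y with hudef
  have huc : ∀ ℓ ∈ S, ∀ k, mFourierCoeff (EuclideanSpace.complexify ∘ ⇑(u ℓ)) k
      = if ((∀ i, (n:ℤ) ∣ k i - ℓ i) ∨ (∀ i, (n:ℤ) ∣ k i + ℓ i)) then mFourierCoeff (EuclideanSpace.complexify ∘ ⇑y) k else 0 :=
    fun ℓ hℓ k => fcoeff_two_smul_pairAvg hn ℓ (hnsc ℓ hℓ) y k
  -- `v ℓ` is carried by `{ℓ, −ℓ}` (slow labels are alone in their class pairs)
  have hvpair : ∀ ℓ ∈ S, ∀ k, k ≠ ℓ → k ≠ -ℓ → mFourierCoeff (EuclideanSpace.complexify ∘ ⇑(v ℓ)) k = 0 := by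
    intro ℓ hℓ k hk1 hk2
    rw [hvc ℓ hℓ k]
    split_ifs with hcp
    · refine hx'S k fun hkS => ?_
      rcases halone ℓ hℓ k hkS hcp with h | h
      exacts [hk1 h, hk2 h]
    · rfl
  -- `u ℓ` vanishes where `y` does
  have huZ : ∀ ℓ ∈ S, ∀ k ∈ Z, mFourierCoeff (EuclideanSpace.complexify ∘ ⇑(u ℓ)) k = 0 := by
    intro ℓ hℓ k hk
    rw [huc ℓ hℓ k]
    split_ifs
    exacts [hyZ k hk, rfl]
  -- `U (v ℓ)` is carried by the class pair of `ℓ` (class preservation + transitivity)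
  have hUv : ∀ ℓ ∈ S, ∀ k, ¬ ((∀ i, (n:ℤ) ∣ k i - ℓ i) ∨ (∀ i, (n:ℤ) ∣ k i + ℓ i)) →
      mFourierCoeff (EuclideanSpace.complexify ∘ ⇑(U (v ℓ))) k = 0 := by
    intro ℓ hℓ k hk
    have hvk : ∀ k', ((∀ i, (n:ℤ) ∣ k' i - k i) ∨ (∀ i, (n:ℤ) ∣ k' i + k i)) →
        mFourierCoeff (EuclideanSpace.complexify ∘ ⇑(v ℓ)) k' = 0 := by
      intro k' hk'
      rw [hvc ℓ hℓ k', if_neg]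
      exact fun hk'ℓ => hk (classPair_of_classPair_of_classPair hk' hk'ℓ)
    exact hUcl k (v ℓ) hvk k (Or.inl fun i => by simp)
  -- `⟪U (v ℓ), y⟫ = ⟪U (v ℓ), u ℓ⟫`
  have hpair_eq : ∀ ℓ ∈ S, ⟪U (v ℓ), y⟫_ℝ = ⟪U (v ℓ), u ℓ⟫_ℝ := by
    intro ℓ hℓ
    rw [← sub_eq_zero, ← inner_sub_right]
    refine inner_eq_zero_of_disjoint_fcoeff fun k => ?_
    by_cases hk : (∀ i, (n:ℤ) ∣ k i - ℓ i) ∨ (∀ i, (n:ℤ) ∣ k i + ℓ i)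
    · right; rw [fcoeff_sub, huc ℓ hℓ k, if_pos hk, sub_self]
    · left; exact hUv ℓ hℓ k hk
  -- ### `2•x' = Σ_{ℓ∈S} v ℓ`, so `⟪U x', y⟫ = ½ Σ_{ℓ∈S} ⟪U (v ℓ), u ℓ⟫`
  have hsum : (2:ℝ) • x' = ∑ ℓ ∈ S, v ℓ := two_smul_eq_sum_pairParts S hn hSneg halone hnsc x' hx'S v hvc
  have hUx' : U x' = (1 / 2 : ℝ) • ∑ ℓ ∈ S, U (v ℓ) := by
    rw [← map_sum, ← hsum, map_smul, smul_smul]; norm_num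
  have hinner : ⟪U x', y⟫_ℝ = (1 / 2 : ℝ) * ∑ ℓ ∈ S, ⟪U (v ℓ), u ℓ⟫_ℝ := by
    rw [hUx', real_inner_smul_left, sum_inner, Finset.sum_congr rfl hpair_eq]
  -- ### per-label sideband bounds and Cauchy–Schwarz over `S`
  have hterm : ∀ ℓ ∈ S, |⟪U (v ℓ), u ℓ⟫_ℝ| ≤ (ε ℓ * ‖v ℓ‖) * ‖u ℓ‖ :=
    fun ℓ hℓ => hsb ℓ hℓ (v ℓ) (hvdiv ℓ) (hvpair ℓ hℓ) (u ℓ) (huZ ℓ hℓ)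
  have hu2 : ∑ ℓ ∈ S, ‖u ℓ‖ ^ 2 ≤ 2 * ‖y‖ ^ 2 := sum_norm_sq_classPairPart_le S halone hnsc y u huc
  have hv2 : ∀ ℓ ∈ S, ‖v ℓ‖ ^ 2 ≤ 2 * ‖mFourierCoeff (EuclideanSpace.complexify ∘ ⇑x) ℓ‖ ^ 2 := by
    intro ℓ hℓ
    have hne : ℓ ≠ -ℓ := fun h => hnsc ℓ hℓ fun i => by
      have hi := congrFun h i; simp only [Pi.neg_apply] at hi
      exact ⟨0, by linarith⟩
    rw [norm_sq_eq_two_mul_of_pair hne (v ℓ) (hvpair ℓ hℓ), hvc ℓ hℓ ℓ, if_pos (Or.inl fun i => by simp)]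
    nlinarith [hdom ℓ, norm_nonneg (mFourierCoeff (EuclideanSpace.complexify ∘ ⇑x') ℓ)]
  have hεv2 : ∑ ℓ ∈ S, (ε ℓ * ‖v ℓ‖) ^ 2 ≤ 2 * ∑ ℓ ∈ S, ε ℓ ^ 2 * ‖mFourierCoeff (EuclideanSpace.complexify ∘ ⇑x) ℓ‖ ^ 2 := by
    rw [Finset.mul_sum]
    refine Finset.sum_le_sum fun ℓ hℓ => ?_
    rw [mul_pow]
    nlinarith [hv2 ℓ hℓ, sq_nonneg (ε ℓ)]
  set A : ℝ := ∑ ℓ ∈ S, ε ℓ ^ 2 * ‖mFourierCoeff (EuclideanSpace.complexify ∘ ⇑x) ℓ‖ ^ 2 with hA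
  have hA0 : 0 ≤ A := Finset.sum_nonneg fun ℓ _ => by positivity
  rw [e0, hinner, abs_mul, abs_of_pos (by norm_num : (0:ℝ) < 1 / 2)]
  calc 1 / 2 * |∑ ℓ ∈ S, ⟪U (v ℓ), u ℓ⟫_ℝ|
      ≤ 1 / 2 * ∑ ℓ ∈ S, |⟪U (v ℓ), u ℓ⟫_ℝ| := by gcongr; exact Finset.abs_sum_le_sum_abs _ _
    _ ≤ 1 / 2 * ∑ ℓ ∈ S, (ε ℓ * ‖v ℓ‖) * ‖u ℓ‖ := by gcongr with ℓ hℓ; exact hterm ℓ hℓ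
    _ ≤ 1 / 2 * (Real.sqrt (∑ ℓ ∈ S, (ε ℓ * ‖v ℓ‖) ^ 2) * Real.sqrt (∑ ℓ ∈ S, ‖u ℓ‖ ^ 2)) := by
        gcongr; exact Real.sum_mul_le_sqrt_mul_sqrt _ _ _
    _ ≤ 1 / 2 * (Real.sqrt (2 * A) * Real.sqrt (2 * ‖y‖ ^ 2)) := by gcongr
    _ = Real.sqrt A * ‖y‖ := by
        rw [Real.sqrt_mul (by norm_num) A, Real.sqrt_mul (by norm_num) (‖y‖ ^ 2), Real.sqrt_sq (norm_nonneg _)]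
        have h2 : Real.sqrt 2 * Real.sqrt 2 = 2 := Real.mul_self_sqrt (by norm_num)
        linear_combination (1 / 2 * Real.sqrt A * ‖y‖) * h2

/-- **(sf) ASSEMBLY, currency shape**: if moreover `ε_ℓ ≤ η·√(d_ℓ)` on `S` (`0 ≤ η`, `0 ≤ d_ℓ`), then
`|⟪U x − T x, y⟫| ≤ η·√(Σ_{ℓ∈S} d_ℓ ‖𝓕x(ℓ)‖²)·‖y‖`. -/
theorem abs_inner_sub_le_sqrt_of_slow_sideband (S : Finset (Fin 3 → ℤ)) (Z : Set (Fin 3 → ℤ)) (U T : V2 →L[ℝ] V2) (ε : (Fin 3 → ℤ) → ℝ)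
    (hn : 0 < n) (hSneg : ∀ k ∈ S, -k ∈ S)
    (halone : ∀ ℓ ∈ S, ∀ k ∈ S, ((∀ i, (n:ℤ) ∣ k i - ℓ i) ∨ (∀ i, (n:ℤ) ∣ k i + ℓ i)) → k = ℓ ∨ k = -ℓ)
    (hnsc : ∀ ℓ ∈ S, ¬ (∀ i, (n:ℤ) ∣ ℓ i + ℓ i)) (hε : ∀ ℓ, 0 ≤ ε ℓ) (hSZ : ∀ k ∈ S, k ∈ Z)
    (hUP : ∀ x : V2, U x = U ((divFreeL2 (Fin 3)).starProjection x))
    (hUcl : ∀ (c : Fin 3 → ℤ) (x : V2), (∀ k', ((∀ i, (n:ℤ) ∣ k' i - c i) ∨ (∀ i, (n:ℤ) ∣ k' i + c i)) →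
        mFourierCoeff (EuclideanSpace.complexify ∘ ⇑x) k' = 0) →
      ∀ k, ((∀ i, (n:ℤ) ∣ k i - c i) ∨ (∀ i, (n:ℤ) ∣ k i + c i)) → mFourierCoeff (EuclideanSpace.complexify ∘ ⇑(U x)) k = 0)
    (hTmode : ∀ (x : V2) (k : Fin 3 → ℤ), mFourierCoeff (EuclideanSpace.complexify ∘ ⇑x) k = 0 →
      mFourierCoeff (EuclideanSpace.complexify ∘ ⇑(T x)) k = 0)
    (hsb : ∀ ℓ ∈ S, ∀ w : V2, w ∈ divFreeL2 (Fin 3) →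
      (∀ k, k ≠ ℓ → k ≠ -ℓ → mFourierCoeff (EuclideanSpace.complexify ∘ ⇑w) k = 0) →
      ∀ y : V2, (∀ k ∈ Z, mFourierCoeff (EuclideanSpace.complexify ∘ ⇑y) k = 0) → |⟪U w, y⟫_ℝ| ≤ ε ℓ * ‖w‖ * ‖y‖)
    (d : (Fin 3 → ℤ) → ℝ) (η : ℝ) (hη : 0 ≤ η) (hd : ∀ ℓ, 0 ≤ d ℓ) (hεd : ∀ ℓ ∈ S, ε ℓ ≤ η * Real.sqrt (d ℓ))
    (x y : V2) (hxS : ∀ k, k ∉ S → mFourierCoeff (EuclideanSpace.complexify ∘ ⇑x) k = 0)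
    (hyZ : ∀ k ∈ Z, mFourierCoeff (EuclideanSpace.complexify ∘ ⇑y) k = 0) :
    |⟪U x - T x, y⟫_ℝ| ≤ η * Real.sqrt (∑ ℓ ∈ S, d ℓ * ‖mFourierCoeff (EuclideanSpace.complexify ∘ ⇑x) ℓ‖ ^ 2) * ‖y‖ := by
  refine (abs_inner_sub_le_of_slow_sideband S Z U T ε hn hSneg halone hnsc hSZ hUP hUcl hTmode hsb x y hxS hyZ).trans ?_
  have h1 : ∑ ℓ ∈ S, ε ℓ ^ 2 * ‖mFourierCoeff (EuclideanSpace.complexify ∘ ⇑x) ℓ‖ ^ 2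
      ≤ η ^ 2 * ∑ ℓ ∈ S, d ℓ * ‖mFourierCoeff (EuclideanSpace.complexify ∘ ⇑x) ℓ‖ ^ 2 := by
    rw [Finset.mul_sum]
    refine Finset.sum_le_sum fun ℓ hℓ => ?_
    have h2 : ε ℓ ^ 2 ≤ (η * Real.sqrt (d ℓ)) ^ 2 := pow_le_pow_left₀ (hε ℓ) (hεd ℓ hℓ) 2
    rw [mul_pow, Real.sq_sqrt (hd ℓ)] at h2
    nlinarith [sq_nonneg ‖mFourierCoeff (EuclideanSpace.complexify ∘ ⇑x) ℓ‖]
  calc Real.sqrt (∑ ℓ ∈ S, ε ℓ ^ 2 * ‖mFourierCoeff (EuclideanSpace.complexify ∘ ⇑x) ℓ‖ ^ 2) * ‖y‖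
      ≤ Real.sqrt (η ^ 2 * ∑ ℓ ∈ S, d ℓ * ‖mFourierCoeff (EuclideanSpace.complexify ∘ ⇑x) ℓ‖ ^ 2) * ‖y‖ := by gcongr
    _ = η * Real.sqrt (∑ ℓ ∈ S, d ℓ * ‖mFourierCoeff (EuclideanSpace.complexify ∘ ⇑x) ℓ‖ ^ 2) * ‖y‖ := by
        rw [Real.sqrt_mul (sq_nonneg _), Real.sqrt_sq hη]

end Summit.AnomalousDissipation.AnomalousDissipation.Theorems.SolenoidalFractalHomogenisation.LagrangianStep.VmodFlat

end
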